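import Mathlib
import Literature.AlgebraicGeometry.Resolution.MaximalPoints
import Literature.AlgebraicGeometry.Dimension.PointDimension
import Summits.ResolutionOfSingularities.ResolutionOfSingularities.Theorems.WeightedInvariantELadderOneStage
import Summits.ResolutionOfSingularities.ResolutionOfSingularities.Theorems.WeightedInvariantELadderOneMeasure
import Summits.ResolutionOfSingularities.ResolutionOfSingularities.Theorems.WeightedInvariantDatumToEmbeddedAtlasAmbientAssembly
import Summits.ResolutionOfSingularities.ResolutionOfSingularities.Theorems.WeightedInvariantDatumToEmbeddedExceptional
import Summits.ResolutionOfSingularities.ResolutionOfSingularities.Theorems.WeightedInvariantWeightedThesisGlobalCobordantPlus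
import Summits.ResolutionOfSingularities.ResolutionOfSingularities.Theorems.WeightedInvariantHomogeneousMinimalPrimes
import Summits.ResolutionOfSingularities.ResolutionOfSingularities.Theorems.WeightedInvariantGradedSimpleOrbitCharts
import Summits.ResolutionOfSingularities.ResolutionOfSingularities.Theorems.WeightedInvariantOrbitChartContraction
import HarnessLib

/-!
# Rung `e = 1`: maximal singular points of the strict transform lie over MAXIMAL singular points

Route `ResolutionOfSingularities/WeightedInvariant`, door crux `HypersurfaceCentreConstruction`
(stmt-ResolutionOfSingularities-19897), e-ladder `e = 1` of `res-L1-w43-stub-10` (cell res-hironaka,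
`D/res-D-pv-025/E1Skeleton.lean`), stub `stub_e1_inv_succ` «torus bookkeeping L1»: the map
`hover : maxSing S' → maxSing S` the drop clause is read through (type-o7's `Stage.mu_lt_mu_of_maps_to`,
`Theorems/WeightedInvariantELadderOneMeasure.lean`).  Statement proved here
(`ELadderOne.Stage.piPlus_mem_maxSing`): for a stage `S` with graded atlas `𝒜`, a regular weighted centre
`R` whose pieces are homogeneous on the atlas charts, its Rees filtration `R'` with cobordant blow-up
`σ₊ : B₊ → Y`, a chart `W a ∋ y := σ₊ η'` on which the primes of the maximal singular points have
GRADED-SIMPLE quotients (clause (I2) of `Stage.Inv`, only needed on this one chart), and a MAXIMAL point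
`η'` of the image of the non-regular locus of the strict transform with `σ₊ η'` in the old singular image:
`σ₊ η' ∈ maxSing S`.

Proof (no equivariance of `σ₊` is invoked; everything is read on ONE affine chart of `B₊`):
* §1 `exists_homogeneous_irrelevant_not_mem` — a prime of the extended Rees algebra `⊕ 𝒥ₙ(W)tⁿ` off the
  vertex misses a BI-HOMOGENEOUS generator `a tⁿ` (`a ∈ 𝒥ₙ(W)` homogeneous, `n > 0`) of the irrelevant
  ideal (the pieces `𝒥ₙ(W)` are homogeneous);
* §2 the chart `D(a tⁿ) ∋ η'` of `B₊` over `W a` (`DatumToEmbedded.AtlasAmbient.exists_chart`,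
  `DatumToEmbedded.Exceptional.exists_mem_plusChart`) carries the `ℤʲ⁺¹`-grading transported from
  `(⊕ 𝒥ₙ tⁿ)[1/a tⁿ]` (`awayPiece` ∘ `subalgebraPiece` ∘ `laurentPiece`, `comapPiece`) for which `σ₊♯` is
  graded (`χ ↦ (χ, 0)`) and the ideal of the strict transform is homogeneous
  (`isHomogeneous_iSup_colon`); hence the prime `P'` of `η'` — a minimal prime over the reduced ideal of the
  singular image (`primeIdealOf_mem_minimalPrimes_of_mem_maxPoints`) — is homogeneous
  (`isHomogeneous_of_mem_minimalPrimes_vanishingIdeal_singSet`, p501807);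
* §3 its contraction to `Γ(Y, W a)` is the prime of `y` (`IsAffineOpen.comap_primeIdealOf_appLE`), hence a
  homogeneous prime over the prime of the maximal singular point `η` generising `y`, hence EQUAL to it by
  graded-simplicity (`comap_eq_of_gradedSimple`, p512316): `y = η`.

Nothing here is a claim about Hironaka's problem; AI-written, weaker than expert review.
-/

noncomputable section

set_option linter.dupNamespace false -- mandated namespace of this single-conjunct summit
-- `Γ(B₊, W')` versus `presheaf.obj` inside `rw` motives and instance problems on the glued scheme
-- `R'.cobordantBlowup` / `R'.plus` (as in `…DatumToEmbedded.AtlasAmbientAssembly`):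
set_option backward.isDefEq.respectTransparency false

open scoped LaurentPolynomial
open LaurentPolynomial CategoryTheory AlgebraicGeometry TopologicalSpace
open Literature.AlgebraicGeometry.Resolution
open Summit.ResolutionOfSingularities.ResolutionOfSingularities.Theorems
open Summit.ResolutionOfSingularities.ResolutionOfSingularities.Theorems.DatumToEmbedded.AtlasAmbient

namespace Summit.ResolutionOfSingularities.ResolutionOfSingularities.Theorems.ELadderOne

/-! ## §1 A bi-homogeneous element of the irrelevant ideal off a given vertex-free prime -/

section Irrelevant

variable {ι A : Type*} [AddCommMonoid ι] [DecidableEq ι] [CommRing A] (𝒜₀ : ι → Submodule ℤ A)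
  [GradedRing 𝒜₀] (F : IdealFiltration A)

/-- **Off the vertex there is a bi-homogeneous `a tⁿ` of the irrelevant ideal outside the prime.**  If the
pieces `𝒥ₙ` of the filtration are homogeneous for the grading `𝒜₀` of `A` and a prime `q` of the extended
Rees algebra `⊕ 𝒥ₙ tⁿ` does not contain the irrelevant ideal `⊕_{n>0} 𝒥ₙ tⁿ`, then some `a tⁿ` with `n > 0`
and `a ∈ 𝒥ₙ` HOMOGENEOUS lies outside `q` (decompose a generator `a tⁿ ∉ q` into its homogeneous components,
all of which lie in `𝒥ₙ tⁿ`). [folklore] -/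
theorem exists_homogeneous_irrelevant_not_mem (hF : ∀ n, (F.ideal n).IsHomogeneous 𝒜₀)
    (q : Ideal F.extendedRees) [q.IsPrime] (hq : ¬ F.irrelevant ≤ q) :
    ∃ (χ : ι) (n : ℕ) (a : A) (ha : a ∈ F.ideal n), a ∈ 𝒜₀ χ ∧ 0 < n ∧
      (⟨C a * T (n : ℤ), F.C_mul_T_mem_extendedRees_iff.mpr ha⟩ : F.extendedRees) ∉ q := by
  classical
  by_contra hcon
  push Not at hcon
  apply hq
  rw [IdealFiltration.irrelevant, Ideal.span_le]
  rintro p ⟨n, a, hn, ha, hp⟩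
  -- decompose `a` into homogeneous components, each in `𝒥ₙ`
  have hcomp : ∀ χ, (DirectSum.decompose 𝒜₀ a χ : A) ∈ F.ideal n := fun χ => hF n χ ha
  have hsum : p = ∑ χ ∈ (DirectSum.decompose 𝒜₀ a).support,
      (⟨C (DirectSum.decompose 𝒜₀ a χ : A) * T (n : ℤ),
        F.C_mul_T_mem_extendedRees_iff.mpr (hcomp χ)⟩ : F.extendedRees) := by
    apply Subtype.ext
    rw [hp, AddSubmonoidClass.coe_finsetSum]
    simp only
    rw [← Finset.sum_mul, ← map_sum]
    congr 2
    exact (DirectSum.sum_support_decompose 𝒜₀ a).symm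
  rw [SetLike.mem_coe, hsum]
  exact q.sum_mem fun χ _ => hcon χ n _ (hcomp χ) (SetLike.coe_mem _) hn

end Irrelevant

/-! ## §2–3 The hover lemma -/

namespace Stage

variable {k : Type} [Field k]

/-- **Maximal singular points of the strict transform lie over maximal singular points.**  Let `S` be a
stage, `R` a regular weighted centre on `S.Y` whose pieces are homogeneous on the charts of the atlas,
`R'` its Rees filtration (`σ₊ : B₊ = R'.plus → Y` smooth over `k` after composition with `S.f`), `a` a chart
of the atlas on which the primes of the maximal singular points of `S` have GRADED-SIMPLE quotients (clause
(I2) of `Stage.Inv` on this chart), and `η'` a maximal point of the image of the non-regular locus of the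
strict transform `V(σˢ(ker i)) ⊆ B₊` with `σ₊ η' ∈ W a` lying in the singular image of `S`.  Then `σ₊ η'`
is a MAXIMAL singular point of `S`.  (Read on the chart `D(c tⁿ) ∋ η'` of `B₊` over `W a`: the prime of `η'`
is homogeneous for the transported `ℤʲ⁺¹`-grading, its contraction along the graded `σ₊♯` is the prime of
`σ₊ η'`, a homogeneous prime over the prime of the maximal point `η ⤳ σ₊ η'`, equal to it by
graded-simplicity.) [folklore] -/
theorem piPlus_mem_maxSing (S : Stage k) (R : ReesAlgebraData S.Y) (hc : R.IsRegularWeightedCentre)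
    (hhom : ∀ (a : S.atlas.ι) (n : ℕ), letI := S.atlas.gradedRing a
      ((R.piece n).ideal (S.atlas.W a)).IsHomogeneous (S.atlas.piece a))
    (R' : ReesFiltration S.Y) (hR' : R'.ideal = R.piece) [Smooth (R'.πPlus ≫ S.f)]
    {a : S.atlas.ι}
    (hI2 : ∀ η ∈ S.maxSing, ∀ (hη : η ∈ (S.atlas.W a : S.Y.Opens)), letI := S.atlas.gradedRing a
      ∀ (d : Fin S.j → ℤ) (x : Γ(S.Y, S.atlas.W a)), x ∈ S.atlas.piece a d →
        x ∉ ((S.atlas.W a).2.primeIdealOf ⟨η, hη⟩).asIdeal →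
          IsUnit (Ideal.Quotient.mk ((S.atlas.W a).2.primeIdealOf ⟨η, hη⟩).asIdeal x))
    (η' : ↥R'.plus)
    (hη'₁ : η' ∈ singImage (R'.strictTransformPlus S.i.ker))
    (hη'₂ : ∀ z ∈ singImage (R'.strictTransformPlus S.i.ker), η' ∈ closure ({z} : Set ↥R'.plus) → z = η')
    (hy : R'.πPlus η' ∈ singImage S.i.ker) (hya : R'.πPlus η' ∈ (S.atlas.W a : S.Y.Opens)) :
    R'.πPlus η' ∈ S.maxSing := by
  classical
  -- Noetherian bookkeeping
  haveI : IsLocallyNoetherian S.Y := LocallyOfFiniteType.isLocallyNoetherian S.f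
  haveI : LocallyOfFiniteType R'.π := WeightedThesis.GlobalCobordantPlus.locallyOfFiniteType_π R R' hR' hc
  haveI : IsLocallyNoetherian R'.cobordantBlowup := LocallyOfFiniteType.isLocallyNoetherian R'.π
  set W : S.Y.affineOpens := S.atlas.W a with hWdef
  letI := S.atlas.gradedRing a
  -- the old side: a maximal singular point `η ⤳ y` in the chart
  set y : S.Y := R'.πPlus η' with hydef
  obtain ⟨η, hηmax, hyη⟩ := S.exists_mem_maxSing_of_mem_singImage hy
  have hηy : η ⤳ y := specializes_iff_mem_closure.mpr hyη
  have hηa : η ∈ (W : S.Y.Opens) := hηy.mem_open W.1.isOpen hya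
  have hle : (W.2.primeIdealOf ⟨η, hηa⟩).asIdeal ≤ (W.2.primeIdealOf ⟨y, hya⟩).asIdeal :=
    (Literature.AlgebraicGeometry.Dimension.Scheme.specializes_iff_primeIdealOf_le W.2 ⟨η, hηa⟩
      ⟨y, hya⟩).mp hηy
  -- the point of the chart `Spec ⊕ 𝒥ₙ(W) tⁿ` of `B` under `η'`, off the vertex
  have hyW : R'.π η'.1 ∈ (W : S.Y.Opens) := hya
  obtain ⟨q₀, hq₀plus, hq₀⟩ := DatumToEmbedded.Exceptional.exists_mem_plusChart R' η'.1 η'.2 W hyW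
  rw [R'.mem_plusChart_iff] at hq₀plus
  -- the gradings: `ℤʲ` on `Γ(Y, W)` by `ℤ`-submodules, `ℤʲ × ℤ` on `Γ(Y, W)[t, t⁻¹]` and on `⊕ 𝒥ₙ tⁿ`
  let 𝒜₀ : (Fin S.j → ℤ) → Submodule ℤ Γ(S.Y, W) := fun χ => AddSubgroup.toIntSubmodule (S.atlas.piece a χ)
  have h𝒜₀ : ∀ χ x, x ∈ 𝒜₀ χ ↔ x ∈ S.atlas.piece a χ := fun _ _ => Iff.rfl
  obtain ⟨inst₀⟩ := DatumToEmbedded.QuotientSingularities.nonempty_gradedRing_of_mem_iff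
    (S.atlas.piece a) 𝒜₀ h𝒜₀
  obtain ⟨inst₁⟩ := nonempty_gradedRing_laurentPiece 𝒜₀
  have hF : ∀ n, ((R'.filtration W).ideal n).IsHomogeneous 𝒜₀ := fun n => by
    rw [ReesFiltration.filtration_ideal, hR']
    exact isHomogeneous_of_mem_iff (S.atlas.piece a) 𝒜₀ h𝒜₀ (hhom a n)
  obtain ⟨inst₂⟩ := nonempty_gradedRing_subalgebraPiece (laurentPiece 𝒜₀)
    (R'.filtration W).extendedRees
    (fun x hx κ => decompose_mem_extendedRees 𝒜₀ (R'.filtration W) hF hx κ)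
  -- a bi-homogeneous `v₀ = c tⁿ` of the irrelevant ideal off `q₀`
  haveI : q₀.asIdeal.IsPrime := q₀.2
  obtain ⟨χ₀, n, c, hcJ, hcχ, hn, hv₀q⟩ :=
    exists_homogeneous_irrelevant_not_mem 𝒜₀ (R'.filtration W) hF q₀.asIdeal hq₀plus
  let v₀ : R'.sectionsRing W :=
    ⟨C c * T (n : ℤ), (R'.filtration W).C_mul_T_mem_extendedRees_iff.mpr hcJ⟩
  have hv₀irr : v₀ ∈ (R'.filtration W).irrelevant := Ideal.subset_span ⟨n, c, hn, hcJ, rfl⟩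
  have hv₀deg : v₀ ∈ subalgebraPiece (laurentPiece 𝒜₀) (R'.filtration W).extendedRees (χ₀, (n : ℤ)) :=
    mem_subalgebraPiece_of_coe_eq 𝒜₀ _ hcχ _ v₀ rfl
  let L : Type := Localization.Away v₀
  let ℳ := awayPiece (subalgebraPiece (laurentPiece 𝒜₀) (R'.filtration W).extendedRees) hv₀deg L
  obtain ⟨inst₃⟩ := nonempty_gradedRing_awayPiece
    (subalgebraPiece (laurentPiece 𝒜₀) (R'.filtration W).extendedRees) hv₀deg L
  -- the chart `D(v₀) ∋ η'` of `B₊`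
  obtain ⟨W', hW', e, he₁, he₂, he₃, he₄⟩ := exists_chart R' W L v₀ hv₀irr
  have hη'W' : η' ∈ (W' : (R'.plus : Scheme.{0}).Opens) := he₄ η' q₀ hq₀ hv₀q
  -- the transported `ℤʲ⁺¹`-grading of `Γ(B₊, W')`
  let g : (Fin (S.j + 1) → ℤ) ≃+ (Fin S.j → ℤ) × ℤ :=
    { toFun := fun v => (Fin.init v, v (Fin.last S.j))
      invFun := fun c => Fin.snoc c.1 c.2
      left_inv := fun v => Fin.snoc_init_self (α := fun _ => ℤ) v
      right_inv := fun c =>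
        Prod.ext (Fin.init_snoc (α := fun _ => ℤ) c.2 c.1) (Fin.snoc_last (α := fun _ => ℤ) c.2 c.1)
      map_add' := fun _ _ => rfl }
  have hg : ∀ (χ : Fin S.j → ℤ) (m : ℤ), g (Fin.snoc (α := fun _ => ℤ) χ m) = (χ, m) :=
    fun χ m => Prod.ext (Fin.init_snoc (α := fun _ => ℤ) m χ) (Fin.snoc_last (α := fun _ => ℤ) m χ)
  obtain ⟨instC⟩ := nonempty_gradedRing_comapPiece e ℳ g
  let piece' : (Fin (S.j + 1) → ℤ) → AddSubgroup Γ((R'.plus : Scheme.{0}), W') :=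
    fun v => (comapPiece e ℳ g v).toAddSubgroup
  have hpiece' : ∀ v x, x ∈ piece' v ↔ e x ∈ ℳ (g v) := fun _ _ => Iff.rfl
  obtain ⟨instP⟩ := DatumToEmbedded.QuotientSingularities.nonempty_gradedRing_of_mem_iff
    (comapPiece e ℳ g) piece' (fun _ _ => Iff.rfl)
  -- `σ₊♯` is graded: old degree `χ` ↦ `(χ, 0)`
  have happ : ∀ (χ : Fin S.j → ℤ), ∀ s ∈ S.atlas.piece a χ,
      (R'.πPlus.appLE W W' hW').hom s ∈ piece' (Fin.snoc (α := fun _ => ℤ) χ 0) := by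
    intro χ s hs
    rw [hpiece', hg]
    change e (R'.πPlus.appLE W W' hW' s) ∈ ℳ (χ, 0)
    rw [he₁]
    exact algebraMap_mem_awayPiece hv₀deg (algebraMap_mem_subalgebraPiece 𝒜₀ _ ((h𝒜₀ χ s).2 hs))
  -- the ideal of the strict transform is homogeneous on the chart
  have hIhom : (S.i.ker.ideal W).IsHomogeneous 𝒜₀ :=
    isHomogeneous_of_mem_iff (S.atlas.piece a) 𝒜₀ h𝒜₀ (S.atlas.isHomogeneous_ker a)
  have ht : algebraMap (R'.sectionsRing W) L
      ⟨T (-1), (R'.filtration W).T_neg_one_mem_extendedRees⟩ ∈ ℳ ((0 : Fin S.j → ℤ), (-1 : ℤ)) :=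
    algebraMap_mem_awayPiece hv₀deg (t_mem_subalgebraPiece 𝒜₀ _)
  have hhomog : (⨆ m : ℕ, ((S.i.ker.ideal W).map ((algebraMap (R'.sectionsRing W) L).comp
      (algebraMap Γ(S.Y, W) (R'.sectionsRing W)))).colon
      ((Ideal.span {algebraMap (R'.sectionsRing W) L
        ⟨T (-1), (R'.filtration W).T_neg_one_mem_extendedRees⟩} ^ m : Ideal L) : Set L)).IsHomogeneous
      ℳ := by
    rw [← Ideal.map_map]
    refine isHomogeneous_iSup_colon _ ht ?_
    refine isHomogeneous_map_algebraMap _ hv₀deg L ?_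
    exact isHomogeneous_map_of_forall' 𝒜₀
      (subalgebraPiece (laurentPiece 𝒜₀) (R'.filtration W).extendedRees)
      (algebraMap Γ(S.Y, W) (R'.filtration W).extendedRees)
      (fun i x hx => ⟨(i, 0), algebraMap_mem_subalgebraPiece 𝒜₀ _ hx⟩) hIhom
  have hST : ((R'.strictTransformPlus S.i.ker).ideal W').IsHomogeneous piece' := by
    rw [he₃ S.i.ker]
    exact isHomogeneous_of_mem_iff (comapPiece e ℳ g) piece' (fun _ _ => Iff.rfl)
      (isHomogeneous_comap e ℳ g hhomog)
  -- the prime of `η'` is homogeneous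
  let Z : Closeds ↥R'.plus :=
    ⟨singImage (R'.strictTransformPlus S.i.ker), isClosed_singSet (R'.πPlus ≫ S.f) _⟩
  have hη'max : η' ∈ maxPoints (singImage (R'.strictTransformPlus S.i.ker)) :=
    ⟨hη'₁, fun z hz hzη' => hη'₂ z hz (specializes_iff_mem_closure.mp hzη')⟩
  have hP'min : (W'.2.primeIdealOf ⟨η', hη'W'⟩).asIdeal ∈
      ((Scheme.IdealSheafData.vanishingIdeal Z).ideal W').minimalPrimes := by
    rw [Scheme.IdealSheafData.vanishingIdeal_ideal]
    exact primeIdealOf_mem_minimalPrimes_of_mem_maxPoints W'.2 Z.2 hη'max hη'W'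
  have hP'hom : ((W'.2.primeIdealOf ⟨η', hη'W'⟩).asIdeal).IsHomogeneous piece' :=
    isHomogeneous_of_mem_minimalPrimes_vanishingIdeal_singSet (R'.πPlus ≫ S.f)
      (R'.strictTransformPlus S.i.ker) Z rfl W' piece' hST hP'min
  -- contraction along `σ₊♯` is the prime of `y`
  have hcomap : ((W'.2.primeIdealOf ⟨η', hη'W'⟩).asIdeal).comap (R'.πPlus.appLE W W' hW').hom =
      (W.2.primeIdealOf ⟨y, hya⟩).asIdeal :=
    congr($(IsAffineOpen.comap_primeIdealOf_appLE (f := R'.πPlus) (x := η') W W.2 W' W'.2 hW' hη'W').1)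
  -- graded-simple descent: the contraction is the prime of `η`
  have hinj : Function.Injective (fun χ : Fin S.j → ℤ => Fin.snoc (α := fun _ => ℤ) χ (0 : ℤ)) := by
    intro χ χ' h
    have h' := congrArg (Fin.init (α := fun _ => ℤ)) h
    simpa only [Fin.init_snoc] using h'
  have key := comap_eq_of_gradedSimple (S.atlas.piece a) piece' (R'.πPlus.appLE W W' hW').hom
    (fun χ : Fin S.j → ℤ => Fin.snoc (α := fun _ => ℤ) χ (0 : ℤ)) hinj happ
    (hI2 η hηmax hηa) hP'hom (W'.2.primeIdealOf ⟨η', hη'W'⟩).2.ne_top (by rw [hcomap]; exact hle)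
  rw [hcomap] at key
  -- hence `y = η`
  have hyη' : (⟨y, hya⟩ : (W : S.Y.Opens)) = ⟨η, hηa⟩ := by
    have hps : W.2.primeIdealOf ⟨y, hya⟩ = W.2.primeIdealOf ⟨η, hηa⟩ := PrimeSpectrum.ext key
    apply Subtype.ext
    rw [← W.2.fromSpec_primeIdealOf ⟨y, hya⟩, ← W.2.fromSpec_primeIdealOf ⟨η, hηa⟩, hps]
  have hyη : y = η := congrArg Subtype.val hyη'
  rw [hyη]
  exact hηmax

end Stage

end Summit.ResolutionOfSingularities.ResolutionOfSingularities.Theorems.ELadderOne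

end
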